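import Mathlib
import Literature.Computability.AlgebraicComplexity.PermanentIrreducible
import Literature.Computability.AlgebraicComplexity.StandardFamiliesProofs
import Summits.ValiantsHypothesis.ValiantsHypothesis.Theorems.DivisionGapPerCofactorDegreeReductionStubTwoTowerCollapse
import Summits.ValiantsHypothesis.ValiantsHypothesis.Theorems.DivisionGapPerCofactorDegreeReductionStubBinaryFormCollapse

/-!
# Crux `DivisionGap.PerCofactorDegreeReduction` (stmt-ValiantsHypothesis-15046), line `Sketch` —
# stub `stub_signedBinaryFormRoot`: a signed binary-form relation between two powers modulo the
# permanent is carried by a real binomial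

**Theorem (`stub_signedBinaryFormRoot`).** Let `n ≥ 1`, let `u, u' ∈ ℝ≥0[x_ij]` (`n × n`
variables) be not divisible by `per_n` over `ℝ`, write `U, U'` for their images in `ℝ[x]`, let
`c₀, …, c_N ∈ ℝ` be not all zero, and suppose `per_n ∣ ∑ᵢ cᵢ (U^p)ⁱ (U'^q)^{N-i}` over `ℝ`.
Then `per_n ∣ U^p - μ U'^q` over `ℝ` for some NONZERO real `μ` (whose sign is not determined).

## Proof

The constants principle, exactly as for `stub_binaryFormCollapse` but without the sign step.
`S = ℂ[x]/(per_n)` is a domain (`perPoly_irreducible`, irreducible is prime in the UFD `ℂ[x]`);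
bars denote classes of complexifications.  For real `A, B` not divisible by `per_n` over `ℝ` one
has `Ā, B̄ ≠ 0` (descent of divisibility from `ℂ` to `ℝ`, `TwoTowerCollapse.per_descent`), and a
relation `per_n ∣ ∑ᵢ cᵢ Aⁱ B^{N-i}` over `ℝ` reads `∑ᵢ c̄ᵢ Āⁱ B̄^{N-i} = 0` in `S`
(`TwoTowerCollapse.per_ascent`).  Hence `Ā = r̄ B̄` for a complex root `r` of `∑ cᵢ Tⁱ`
(`BinaryFormCollapse.exists_root_of_binaryForm_eq_zero`: in the fraction field of `S` the quotient
`Ā / B̄` is a root of this nonzero complex polynomial, which splits over `ℂ`).  The constant `r`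
is real (imaginary parts, `TwoTowerCollapse.dvd_of_map_dvd_sub_C_mul`, else `per_n ∣ B`) and
nonzero (else `Ā = 0`), so `μ = r` gives `Ā - μ̄ B̄ = 0`, i.e. `per_n ∣ A - μ B` over `ℂ` and
hence over `ℝ` (`per_descent`): this is `exists_sub_C_mul_of_binaryForm_dvd`.  The stub is the
case `A = U^p`, `B = U'^q`, which are not divisible by the prime `per_n` (`perPoly_irreducible`
in the UFD `ℝ[x]`) because `U, U'` are not (`p, q ≥ 1`; for `p = 0` or `q = 0` the statement
would still hold, `per_n` not dividing `1`).

Leans on the tree only: `BinaryFormCollapse.exists_root_of_binaryForm_eq_zero`,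
`TwoTowerCollapse.{per_descent, per_ascent, dvd_of_map_dvd_sub_C_mul}`, `perPoly_irreducible`,
`perPoly_ne_zero`, `map_perPoly`; Mathlib.  No definitions.
-/

noncomputable section

-- `Summit.ValiantsHypothesis.ValiantsHypothesis.…` is the tree's mandated single-conjunct layout
-- (Problem = Summit), so the duplicated namespace component is intended.
set_option linter.dupNamespace false

namespace Summit.ValiantsHypothesis.ValiantsHypothesis.Theorems.DivisionGap.PerCofactorDegreeReduction.SignedBinaryFormRoot

open MvPolynomial Literature.Computability.AlgebraicComplexity
open Summit.ValiantsHypothesis.ValiantsHypothesis.Theorems.DivisionGap.PerCofactorDegreeReduction.TwoTowerCollapse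
  (per_descent per_ascent dvd_of_map_dvd_sub_C_mul)
open Summit.ValiantsHypothesis.ValiantsHypothesis.Theorems.DivisionGap.PerCofactorDegreeReduction.BinaryFormCollapse
  (exists_root_of_binaryForm_eq_zero)
open scoped NNReal BigOperators

/-- **Signed binary-form relations modulo the permanent are binomial.**  For `n ≥ 1`, real
`A, B ∈ ℝ[x_ij]` not divisible by `per_n`, and real `c₀, …, c_N` not all zero with
`per_n ∣ ∑ᵢ cᵢ Aⁱ B^{N-i}` over `ℝ`: `per_n ∣ A - μ B` over `ℝ` for some real `μ ≠ 0`.  Proof in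
the domain `S_n = ℂ[x]/(per_n)` (`perPoly_irreducible`): the classes satisfy
`∑ c̄ᵢ Āⁱ B̄^{N-i} = 0` with `B̄ ≠ 0`, so `Ā = r̄ B̄` for a complex root `r` of `∑ cᵢ Tⁱ`
(`exists_root_of_binaryForm_eq_zero`); `r` is real (imaginary parts, else `per_n ∣ B`) and
nonzero (else `per_n ∣ A`), and `μ = r` works, over `ℂ` and hence over `ℝ`. [folklore] -/
theorem exists_sub_C_mul_of_binaryForm_dvd {n N : ℕ} (hn : 1 ≤ n)
    {A B : MvPolynomial (Fin n × Fin n) ℝ} (hA : ¬ perPoly (Fin n) ℝ ∣ A)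
    (hB : ¬ perPoly (Fin n) ℝ ∣ B) {c : Fin (N + 1) → ℝ} (hc : c ≠ 0)
    (hdvd : perPoly (Fin n) ℝ ∣
      ∑ i : Fin (N + 1), C (c i) * (A ^ (i : ℕ) * B ^ (N - (i : ℕ)))) :
    ∃ μ : ℝ, μ ≠ 0 ∧ perPoly (Fin n) ℝ ∣ A - C μ * B := by
  classical
  haveI : Nonempty (Fin n) := ⟨⟨0, hn⟩⟩
  -- `S_n = ℂ[x]/(per_n)` is a domain
  haveI hprime : (Ideal.span {perPoly (Fin n) ℂ}).IsPrime :=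
    (Ideal.span_singleton_prime (perPoly_ne_zero (Fin n) ℂ)).2
      (UniqueFactorizationMonoid.irreducible_iff_prime.mp
        (perPoly_irreducible (n := Fin n) (R := ℂ)))
  haveI : IsDomain (MvPolynomial (Fin n × Fin n) ℂ ⧸ Ideal.span {perPoly (Fin n) ℂ}) :=
    (Ideal.Quotient.isDomain_iff_prime _).2 hprime
  -- the reduction map `Ψ : ℝ[x] → ℂ[x] → S_n` and the constants `κ : ℂ → S_n`
  obtain ⟨Ψ, hΨdef⟩ : ∃ Ψ : MvPolynomial (Fin n × Fin n) ℝ →+*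
      MvPolynomial (Fin n × Fin n) ℂ ⧸ Ideal.span {perPoly (Fin n) ℂ},
      Ψ = (Ideal.Quotient.mk (Ideal.span {perPoly (Fin n) ℂ})).comp
        (MvPolynomial.map Complex.ofRealHom) := ⟨_, rfl⟩
  obtain ⟨κ, hκdef⟩ : ∃ κ : ℂ →+* MvPolynomial (Fin n × Fin n) ℂ ⧸ Ideal.span {perPoly (Fin n) ℂ},
      κ = (Ideal.Quotient.mk (Ideal.span {perPoly (Fin n) ℂ})).comp MvPolynomial.C := ⟨_, rfl⟩
  have hΨ : ∀ p, Ψ p = Ideal.Quotient.mk (Ideal.span {perPoly (Fin n) ℂ})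
      (MvPolynomial.map Complex.ofRealHom p) := fun p => by
    rw [hΨdef]; rfl
  have hκ : ∀ z, κ z = Ideal.Quotient.mk (Ideal.span {perPoly (Fin n) ℂ}) (C z) := fun z => by
    rw [hκdef]; rfl
  have hΨ0 : ∀ p, Ψ p = 0 ↔ perPoly (Fin n) ℂ ∣ MvPolynomial.map Complex.ofRealHom p :=
    fun p => by rw [hΨ, Ideal.Quotient.eq_zero_iff_mem, Ideal.mem_span_singleton]
  have hΨC : ∀ a : ℝ, Ψ (C a) = κ (a : ℂ) := fun a => by
    rw [hΨ, hκ, MvPolynomial.map_C, Complex.ofRealHom_eq_coe]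
  -- the relation `∑ c̄ᵢ Āⁱ B̄^{N-i} = 0` in `S_n`; `Ā, B̄ ≠ 0`
  have hrel : ∑ i : Fin (N + 1), κ (c i : ℂ) * (Ψ A ^ (i : ℕ) * Ψ B ^ (N - (i : ℕ))) = 0 := by
    have h := (hΨ0 _).2 (per_ascent hdvd)
    simpa only [map_sum, map_mul, map_pow, hΨC] using h
  have hA' : Ψ A ≠ 0 := fun h => hA (per_descent ((hΨ0 A).1 h))
  have hB' : Ψ B ≠ 0 := fun h => hB (per_descent ((hΨ0 B).1 h))
  -- `Ā = r̄ B̄` for a complex root `r` of `∑ cᵢ Tⁱ`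
  obtain ⟨i₀, hi₀⟩ := Function.ne_iff.1 hc
  have hc' : (fun i => (c i : ℂ)) ≠ 0 := Function.ne_iff.2
    ⟨i₀, by simpa only [Pi.zero_apply, Ne, Complex.ofReal_eq_zero] using hi₀⟩
  obtain ⟨r, -, hAB⟩ := exists_root_of_binaryForm_eq_zero κ hc' hB' hrel
  -- `per_n ∣ A - r B` over `ℂ`
  have hdiv : perPoly (Fin n) ℂ ∣
      MvPolynomial.map Complex.ofRealHom A - C r * MvPolynomial.map Complex.ofRealHom B := by
    rw [← Ideal.mem_span_singleton, ← Ideal.Quotient.eq_zero_iff_mem, map_sub, map_mul, ← hΨ,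
      ← hΨ, ← hκ, hAB, sub_self]
  -- `r` is real: otherwise `per_n ∣ B`
  have hrim : r.im = 0 := by
    by_contra hrim
    exact hB (dvd_of_map_dvd_sub_C_mul (r := A) hrim (by rwa [map_perPoly]))
  have hr : r = ((r.re : ℝ) : ℂ) := Complex.ext (by simp) (by simp [hrim])
  -- `r ≠ 0`: otherwise `Ā = 0`
  have hre0 : r.re ≠ 0 := by
    intro hre0
    apply hA'
    rw [hAB, hr, hre0, Complex.ofReal_zero, map_zero, zero_mul]
  -- `μ = r`: `Ā - μ̄ B̄ = 0`
  refine ⟨r.re, hre0, per_descent ((hΨ0 _).1 ?_)⟩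
  rw [map_sub, map_mul, hΨC, ← hr, hAB, sub_self]

/-- **stub_signedBinaryFormRoot — A SIGNED BINARY-FORM RELATION BETWEEN TWO POWERS MODULO THE
PERMANENT IS CARRIED BY A REAL BINOMIAL.**  For `n ≥ 1`, `u, u' ∈ ℝ≥0[x_ij]` not divisible by
`per_n` over `ℝ` (real images `U, U'`), real `c₀, …, c_N` not all zero and
`per_n ∣ ∑ᵢ cᵢ (U^p)ⁱ (U'^q)^{N-i}` over `ℝ`: `per_n ∣ U^p - μ U'^q` over `ℝ` for some real
`μ ≠ 0`.  This is `exists_sub_C_mul_of_binaryForm_dvd` for `A = U^p`, `B = U'^q`, not divisible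
by the prime `per_n` (`perPoly_irreducible`) since `U, U'` are not (`p, q ≥ 1`). [folklore] -/
theorem stub_signedBinaryFormRoot (n N p q : ℕ) (hn : 1 ≤ n) (hp : 1 ≤ p) (hq : 1 ≤ q)
    (u u' : MvPolynomial (Fin n × Fin n) ℝ≥0)
    (hu : ¬ perPoly (Fin n) ℝ ∣ MvPolynomial.map NNReal.toRealHom u)
    (hu' : ¬ perPoly (Fin n) ℝ ∣ MvPolynomial.map NNReal.toRealHom u')
    (c : Fin (N + 1) → ℝ) (hc : c ≠ 0)
    (hdvd : perPoly (Fin n) ℝ ∣ ∑ i : Fin (N + 1), C (c i) *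
      ((MvPolynomial.map NNReal.toRealHom u ^ p) ^ (i : ℕ) *
        (MvPolynomial.map NNReal.toRealHom u' ^ q) ^ (N - (i : ℕ)))) :
    ∃ μ : ℝ, μ ≠ 0 ∧ perPoly (Fin n) ℝ ∣
      MvPolynomial.map NNReal.toRealHom u ^ p - C μ * MvPolynomial.map NNReal.toRealHom u' ^ q := by
  haveI : Nonempty (Fin n) := ⟨⟨0, hn⟩⟩
  have hprime : Prime (perPoly (Fin n) ℝ) :=
    UniqueFactorizationMonoid.irreducible_iff_prime.mp perPoly_irreducible
  exact exists_sub_C_mul_of_binaryForm_dvd (A := MvPolynomial.map NNReal.toRealHom u ^ p)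
    (B := MvPolynomial.map NNReal.toRealHom u' ^ q) hn
    (fun h => hu ((hprime.dvd_pow_iff_dvd (Nat.one_le_iff_ne_zero.mp hp)).mp h))
    (fun h => hu' ((hprime.dvd_pow_iff_dvd (Nat.one_le_iff_ne_zero.mp hq)).mp h)) hc hdvd

end Summit.ValiantsHypothesis.ValiantsHypothesis.Theorems.DivisionGap.PerCofactorDegreeReduction.SignedBinaryFormRoot

end
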